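import Summits.QuantumFields.YangMills.Theorems.AlphaInputsT3ACv3ExpWalkSecondOrder
import Literature.MathematicalPhysics.QuantumFieldTheory.Balaban1983to89.BlockAveragingEMLProp2
import Literature.MathematicalPhysics.QuantumFieldTheory.Balaban1983to89.LatticeWordStokes
import Summits.QuantumFields.YangMills.Theorems.UnitScaleTiltProp7AvgTrueLinearisationDiff
import HarnessLib

/-!
# `AlphaInputsT3ACv3EMLSecondOrder` — STRATEGY B for 2′, NON-ABELIAN (FL) input (B2): [Balaban1985Averaging] PROP. 3 TO **SECOND ORDER** AT THE FLAT
# BACKGROUND FOR AN EXPONENTIAL FIELD — `log Ū(c) = (mean loop sums + axial sum) + ½·(commutator form) + O((ℓ·sup‖Y‖)³)` for the (0.4)∕`exp[mean log]`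
# average of `U_b = e^{Y_b}` — lane `pub-balaban3d` ∕ cell `ym3-torus`, seat `ym-ust-19936-w1` (g0)

WHY (HOME `ym-ust-19936-w1/NONABELIAN-FL-ARCH-w1-g0.md` §8, evidence #52 on stmt-QuantumFields-19936): the k-uniform level-by-level exact lift needs
SECOND-ORDER candidates, hence the explicit quadratic term of `log Ū(c)` with a CUBIC remainder (print: (122)–(123) give everything beyond first order as
`C(V₀, A, c)` with `|C| ≤ C₁L²|A|²`; the tree's `BlockAveragingEMLLinearised` is the first order with remainder `81(ℓδ)²`).  KEY FACT: the correction factor of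
(0.4) is `exp[|I|⁻¹Σᵢ log Wᵢ]` EXACTLY (`BlockAveragingEMLProp2.coe_avg_eq_eml`, `ExpMeanLog.eml_eq_exp`) — so all of the second order comes from the
Baker–Campbell–Hausdorff series of the loop and line transports (`…v3ExpWalkSecondOrder.norm_mlog_holAt_sub_second_order_le`, from the tree's
`Literature.Analysis.Calculus.BCH`) and from the one product `exp(X̄)·U(c)` (`BCH.norm_logOnePlus_sub_bch3_le_mul`).
THE STATEMENT (`norm_mlog_avgFun_sub_second_order_le`).  `U_b = e^{Y_b}`, `Y_b* = −Y_b`, `‖Y_b‖ ≤ δ`, `ℓ = (d+2)L`, `ℓδ ≤ 1/100`, `2ℓδ < δ_N`.  With the loop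
walks `Γᵢ = walk (emb c₋) (loopWord …)` of (0.4), the axial walk `Λ = walk (emb c₋) (L·e_μ)`, their signed letter lists `±Y`, `wᵢ = Y(Γᵢ)`, `w_Λ = Y(Λ)`
(`walkSum`), `pᵢ = pairBr(±Y along Γᵢ)`, `p_Λ`:
  `‖log Ū(c) − [ (|I|⁻¹Σᵢ wᵢ + w_Λ) + ½(|I|⁻¹Σᵢ pᵢ + p_Λ + [|I|⁻¹Σᵢ wᵢ, w_Λ]) ]‖ ≤ 300000·(ℓδ)³`.
The first bracket is the linearised average (the tree's `linAvg`, up to the walk bookkeeping `Y(Γᵢ) = Y(Γ^σ) + Y([x,x′]) − Y(Γ^{σ′}) − Y(Λ)`, next file); the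
second is `B₂(Y)(c)` of the memo — a sum of COMMUTATORS, zero for abelian data.
HONEST FRAMING.  Kernel assembly; nothing of [Balaban1985Averaging] asserted beyond what is proved; constants generous.  Count-neutral helper toward R3 2′
(items 19936∕19935∕20520: input (B2) of the non-abelian (FL) architecture); registry untouched; (FL) NOT proved here; nothing about d = 4, the continuum, or a
mass gap; YM₃ on T³ is rung R3, not Clay.

References: T. Bałaban, Commun. Math. Phys. 98 (1985) 17–51 [Balaban1985Averaging] (Prop. 3 (121)–(125) p.36, (21) p.21); CMP 109 (1987) 249–301 [Balaban1987RG1]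
((0.4), (0.8) p.253); CMP 102 (1985) 277–309 [Balaban1985Variational] ((34) p.283).
-/

set_option autoImplicit false

noncomputable section

open scoped Matrix.Norms.L2Operator
open NormedSpace

namespace Summit.QuantumFields.YangMills.Theorems.EMLSecondOrder

open Literature.MathematicalPhysics.QuantumFieldTheory.Balaban1983to89
open T4Continuum BlockAveraging AveragingRT MatrixLog LatticeWordStokes
open ExpMeanLog (deltaSU expMeanLogSU eml eml_eq_exp)
open BlockAveragingEMLLinearised (walkSum length_walk)
open Literature.Analysis.Calculus.BCH (pairBr bch3 ns ns_nonneg norm_pairBr_le norm_prodExp_sub_one_le norm_logOnePlus_sub_bch3_le_mul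
  exp_sub_one_le_of_le_tenth)
open Literature.Analysis.Complex (logOnePlus)
open Summit.QuantumFields.YangMills.Theorems.ExpWalkSecondOrder (coe_holAt_eq_prodExp ns_signed_le sum_signed_eq_walkSum
  norm_mlog_holAt_sub_second_order_le)
open Summit.QuantumFields.YangMills.Theorems.Prop7HolRatioPerStep (norm_mean_le')

variable {P : Params} {j : ℕ} {n : Type*} [Fintype n] [DecidableEq n] [Nonempty n]

/-! ## §1 Letters (the uniform-mean bound is the tree's `Prop7HolRatioPerStep.norm_mean_le'`) -/

omit [Nonempty n] in
/-- The cubic words of the two-factor BCH polynomial: `‖bch3 X Y − (X + Y + ½[X,Y])‖ ≤ (1/12)(‖X‖+‖Y‖)³`. [cite: Balaban1985Variational, (34) p.283] -/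
theorem norm_bch3_sub_second_order_le (X Y : Matrix n n ℂ) :
    ‖bch3 X Y - (X + Y + (2 : ℂ)⁻¹ • ⁅X, Y⁆)‖ ≤ 12⁻¹ * (‖X‖ + ‖Y‖) ^ 3 := by
  have e : bch3 X Y - (X + Y + (2 : ℂ)⁻¹ • ⁅X, Y⁆) =
      (12 : ℂ)⁻¹ • ((X * (X * Y - Y * X) - (X * Y - Y * X) * X) + (Y * (Y * X - X * Y) - (Y * X - X * Y) * Y)) := by
    simp only [bch3, Ring.lie_def]; abel
  rw [e, norm_smul, norm_inv]
  have h12 : ‖(12 : ℂ)‖ = 12 := by simp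
  rw [h12]
  have hx := norm_nonneg X
  have hy := norm_nonneg Y
  have hXY : ‖X * Y - Y * X‖ ≤ 2 * ‖X‖ * ‖Y‖ := by
    calc ‖X * Y - Y * X‖ ≤ ‖X * Y‖ + ‖Y * X‖ := norm_sub_le _ _
      _ ≤ ‖X‖ * ‖Y‖ + ‖Y‖ * ‖X‖ := add_le_add (norm_mul_le _ _) (norm_mul_le _ _)
      _ = 2 * ‖X‖ * ‖Y‖ := by ring
  have hYX : ‖Y * X - X * Y‖ ≤ 2 * ‖X‖ * ‖Y‖ := by rw [← norm_neg]; simpa using hXY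
  have h1 : ‖X * (X * Y - Y * X) - (X * Y - Y * X) * X‖ ≤ 4 * ‖X‖ ^ 2 * ‖Y‖ := by
    calc _ ≤ ‖X * (X * Y - Y * X)‖ + ‖(X * Y - Y * X) * X‖ := norm_sub_le _ _
      _ ≤ ‖X‖ * ‖X * Y - Y * X‖ + ‖X * Y - Y * X‖ * ‖X‖ := add_le_add (norm_mul_le _ _) (norm_mul_le _ _)
      _ ≤ ‖X‖ * (2 * ‖X‖ * ‖Y‖) + (2 * ‖X‖ * ‖Y‖) * ‖X‖ := by gcongr
      _ = 4 * ‖X‖ ^ 2 * ‖Y‖ := by ring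
  have h2 : ‖Y * (Y * X - X * Y) - (Y * X - X * Y) * Y‖ ≤ 4 * ‖Y‖ ^ 2 * ‖X‖ := by
    calc _ ≤ ‖Y * (Y * X - X * Y)‖ + ‖(Y * X - X * Y) * Y‖ := norm_sub_le _ _
      _ ≤ ‖Y‖ * ‖Y * X - X * Y‖ + ‖Y * X - X * Y‖ * ‖Y‖ := add_le_add (norm_mul_le _ _) (norm_mul_le _ _)
      _ ≤ ‖Y‖ * (2 * ‖X‖ * ‖Y‖) + (2 * ‖X‖ * ‖Y‖) * ‖Y‖ := by gcongr
      _ = 4 * ‖Y‖ ^ 2 * ‖X‖ := by ring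
  calc 12⁻¹ * ‖(X * (X * Y - Y * X) - (X * Y - Y * X) * X) + (Y * (Y * X - X * Y) - (Y * X - X * Y) * Y)‖
      ≤ 12⁻¹ * (4 * ‖X‖ ^ 2 * ‖Y‖ + 4 * ‖Y‖ ^ 2 * ‖X‖) :=
        mul_le_mul_of_nonneg_left ((norm_add_le _ _).trans (add_le_add h1 h2)) (by norm_num)
    _ ≤ 12⁻¹ * (‖X‖ + ‖Y‖) ^ 3 := by nlinarith [mul_nonneg hx hy, sq_nonneg (‖X‖ - ‖Y‖)]

/-! ## §2 The second-order expansion of the (0.4) average of an exponential field -/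

/-- **★★ [Balaban1985Averaging] PROP. 3 TO SECOND ORDER AT THE FLAT BACKGROUND, EXPONENTIAL FIELD, CUBIC REMAINDER.**  `U_b = e^{Y_b}`, `Y_b* = −Y_b`,
`‖Y_b‖ ≤ δ`, `ℓ = (d+2)L`, `ℓδ ≤ 1/100`, `2ℓδ < δ_N`.  With `Γᵢ` the loop walks of (0.4) from `emb c₋`, `Λ` the axial walk, `wᵢ = Y(Γᵢ)`, `w_Λ = Y(Λ)`
(signed sums), `pᵢ`, `p_Λ` the commutator sums `Σ_{s<s′}[±Y, ±Y]` of their signed letter lists (`BCH.pairBr`):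
`‖log Ū(c) − [(|I|⁻¹Σᵢwᵢ + w_Λ) + ½(|I|⁻¹Σᵢpᵢ + p_Λ + [|I|⁻¹Σᵢwᵢ, w_Λ])]‖ ≤ 300000·(ℓδ)³`.  The quadratic bracket is a sum of commutators (zero for
abelian data, where the abelian (LL) row's `AbelianEML.iter_blockAvg_gexpAt` is EXACT). [cite: Balaban1985Averaging, Prop. 3 (121)-(125) p.36; Balaban1987RG1, (0.4) and (0.8) p.253] -/
theorem norm_mlog_avgFun_sub_second_order_le (U : GaugeField P j (Matrix.specialUnitaryGroup n ℂ)) (Y : PBond P j → Matrix n n ℂ)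
    (hUY : ∀ b, ((U b : Matrix.specialUnitaryGroup n ℂ) : Matrix n n ℂ) = exp (Y b)) (hY : ∀ b, star (Y b) = -Y b)
    {δ : ℝ} (hδ : 0 ≤ δ) (hYδ : ∀ b, ‖Y b‖ ≤ δ)
    (h100 : 100 * ((((P.d + 2) * P.L : ℕ) : ℝ) * δ) ≤ 1) (hN : 2 * ((((P.d + 2) * P.L : ℕ) : ℝ) * δ) < deltaSU n)
    (c : PBond P (j + 1)) :
    ‖mlog ((avgFun (expMeanLogSU (n := n)) U c : Matrix.specialUnitaryGroup n ℂ) : Matrix n n ℂ) -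
        ((((Fintype.card (Idx P) : ℂ))⁻¹ • ∑ i : Idx P, walkSum Y (walk (emb c.src) (loopWord P.L c.dir (off i.1) i.2.1 i.2.2)) +
            walkSum Y (walk (emb c.src) (List.replicate P.L (c.dir, true)))) +
          (2 : ℂ)⁻¹ • ((((Fintype.card (Idx P) : ℂ))⁻¹ • ∑ i : Idx P,
                pairBr ((walk (emb c.src) (loopWord P.L c.dir (off i.1) i.2.1 i.2.2)).map fun s => if s.fwd then Y s.bond else -Y s.bond)) +
              pairBr ((walk (emb c.src) (List.replicate P.L (c.dir, true))).map fun s => if s.fwd then Y s.bond else -Y s.bond) +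
              ⁅((Fintype.card (Idx P) : ℂ))⁻¹ • ∑ i : Idx P, walkSum Y (walk (emb c.src) (loopWord P.L c.dir (off i.1) i.2.1 i.2.2)),
                walkSum Y (walk (emb c.src) (List.replicate P.L (c.dir, true)))⁆))‖ ≤
      300000 * ((((P.d + 2) * P.L : ℕ) : ℝ) * δ) ^ 3 := by
  -- letters
  set ℓ : ℝ := (((P.d + 2) * P.L : ℕ) : ℝ) with hℓ
  set σ : ℝ := ℓ * δ with hσ
  have hℓ0 : 0 ≤ ℓ := Nat.cast_nonneg _
  have hσ0 : 0 ≤ σ := mul_nonneg hℓ0 hδ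
  have hσ1 : σ ≤ 1 / 100 := by linarith only [h100]
  have hσ10 : σ ≤ 1 / 10 := by linarith only [hσ1]
  -- abbreviations matching the statement (in this order, so that the goal is rewritten syntactically)
  set Λ : List (LStep P j) := walk (emb c.src) (List.replicate P.L (c.dir, true)) with hΛ
  set wbar : Matrix n n ℂ := ((Fintype.card (Idx P) : ℂ))⁻¹ •
    ∑ i : Idx P, walkSum Y (walk (emb c.src) (loopWord P.L c.dir (off i.1) i.2.1 i.2.2)) with hwbar
  set pbar : Matrix n n ℂ := ((Fintype.card (Idx P) : ℂ))⁻¹ • ∑ i : Idx P,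
    pairBr ((walk (emb c.src) (loopWord P.L c.dir (off i.1) i.2.1 i.2.2)).map fun s => if s.fwd then Y s.bond else -Y s.bond) with hpbar
  set pΛ : Matrix n n ℂ := pairBr (Λ.map fun s => if s.fwd then Y s.bond else -Y s.bond) with hpΛ
  -- the loop walks and signed lists (proof-internal abbreviations)
  set γ : Idx P → List (LStep P j) := fun i => walk (emb c.src) (loopWord P.L c.dir (off i.1) i.2.1 i.2.2) with hγ
  set sg : List (LStep P j) → List (Matrix n n ℂ) := fun g => g.map fun s => if s.fwd then Y s.bond else -Y s.bond with hsg
  -- lengths: `|Γᵢ| ≤ ℓ`, `|Λ| = L ≤ ℓ`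
  have hlenγ : ∀ i, ((γ i).length : ℝ) * δ ≤ σ := by
    intro i
    have h : (γ i).length ≤ (P.d + 2) * P.L := by
      simp only [hγ, length_walk]; exact length_loopWord_le c i
    have h' : ((γ i).length : ℝ) ≤ ℓ := by rw [hℓ]; exact_mod_cast h
    exact mul_le_mul_of_nonneg_right h' hδ
  have hlenΛ : (Λ.length : ℝ) * δ ≤ σ := by
    have h : Λ.length ≤ (P.d + 2) * P.L := by
      simp only [hΛ, length_walk, List.length_replicate]; exact Nat.le_mul_of_pos_left _ (by omega)
    have h' : (Λ.length : ℝ) ≤ ℓ := by rw [hℓ]; exact_mod_cast h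
    exact mul_le_mul_of_nonneg_right h' hδ
  -- the loop and line transports: exponential products and their size
  set W : Idx P → Matrix n n ℂ := fun i => ((loopHol U c i : Matrix.specialUnitaryGroup n ℂ) : Matrix n n ℂ) with hW
  set S : Matrix n n ℂ := ((axialAvg U c : Matrix.specialUnitaryGroup n ℂ) : Matrix n n ℂ) with hS
  have hWprod : ∀ i, W i = ((sg (γ i)).map exp).prod := fun i => by
    simp only [hW, loopHol]; exact coe_holAt_eq_prodExp U Y hUY hY _
  have hSprod : S = ((sg Λ).map exp).prod := by
    simp only [hS, axialAvg_eq_holAt_walk]; exact coe_holAt_eq_prodExp U Y hUY hY _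
  have hexpσ : Real.exp σ - 1 ≤ 2 * σ := by
    have := exp_sub_one_le_of_le_tenth hσ0 hσ10; nlinarith only [this, hσ0, hσ10]
  have hW1 : ∀ i, ‖W i - 1‖ ≤ 2 * σ := by
    intro i
    rw [hWprod i]
    refine (norm_prodExp_sub_one_le _).trans ?_
    have hns : ns (sg (γ i)) ≤ σ := (ns_signed_le Y hYδ (γ i)).trans (hlenγ i)
    calc Real.exp (ns (sg (γ i))) - 1 ≤ Real.exp σ - 1 := by gcongr
      _ ≤ 2 * σ := hexpσ
  have hS1 : ‖S - 1‖ ≤ 2 * σ := by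
    rw [hSprod]
    refine (norm_prodExp_sub_one_le _).trans ?_
    have hns : ns (sg Λ) ≤ σ := (ns_signed_le Y hYδ Λ).trans hlenΛ
    calc Real.exp (ns (sg Λ)) - 1 ≤ Real.exp σ - 1 := by gcongr
      _ ≤ 2 * σ := hexpσ
  -- second-order logarithms of the transports
  set R : Idx P → Matrix n n ℂ := fun i => mlog (W i) - (walkSum Y (γ i) + (2 : ℂ)⁻¹ • pairBr (sg (γ i))) with hR
  have hRi : ∀ i, ‖R i‖ ≤ 3400 * σ ^ 3 := by
    intro i
    have h := norm_mlog_holAt_sub_second_order_le U Y hUY hY hYδ (γ i) ((hlenγ i).trans hσ10)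
    refine h.trans ?_
    gcongr
    exact hlenγ i
  set RS : Matrix n n ℂ := mlog S - (walkSum Y Λ + (2 : ℂ)⁻¹ • pΛ) with hRS
  have hRS' : ‖RS‖ ≤ 3400 * σ ^ 3 := by
    have h := norm_mlog_holAt_sub_second_order_le U Y hUY hY hYδ Λ (hlenΛ.trans hσ10)
    rw [hRS, hS, axialAvg_eq_holAt_walk]
    refine h.trans ?_
    gcongr
  -- sizes of the first- and second-order letters
  have hwγ : ∀ i, ‖walkSum Y (γ i)‖ ≤ σ := fun i => by
    rw [← sum_signed_eq_walkSum]
    exact (Literature.Analysis.Calculus.BCH.norm_sum_le_ns _).trans ((ns_signed_le Y hYδ _).trans (hlenγ i))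
  have hwΛ : ‖walkSum Y Λ‖ ≤ σ := by
    rw [← sum_signed_eq_walkSum]
    exact (Literature.Analysis.Calculus.BCH.norm_sum_le_ns _).trans ((ns_signed_le Y hYδ _).trans hlenΛ)
  have hpγ : ∀ i, ‖pairBr (sg (γ i))‖ ≤ σ ^ 2 := fun i => by
    refine (norm_pairBr_le _).trans ?_
    have h0 := ns_nonneg (sg (γ i))
    have h1 : ns (sg (γ i)) ≤ σ := (ns_signed_le Y hYδ _).trans (hlenγ i)
    gcongr
  have hpΛ' : ‖pΛ‖ ≤ σ ^ 2 := by
    refine (norm_pairBr_le _).trans ?_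
    have h0 := ns_nonneg (sg Λ)
    have h1 : ns (sg Λ) ≤ σ := (ns_signed_le Y hYδ _).trans hlenΛ
    gcongr
  -- the correction factor is EXACTLY `exp(X̄)`, `X̄ = |I|⁻¹ Σ log Wᵢ`
  have hsmall : Small (expMeanLogSU (n := n)) U c := by
    intro i
    rw [FederbushMean.dist1_SU_eq]
    exact (hW1 i).trans_lt (by rw [hσ]; exact hN)
  set Xbar : Matrix n n ℂ := ((Fintype.card (Idx P) : ℂ))⁻¹ • ∑ i, mlog (W i) with hXbar
  have hcorr : ((corr (expMeanLogSU (n := n)) U c : Matrix.specialUnitaryGroup n ℂ) : Matrix n n ℂ) = exp Xbar := by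
    unfold corr
    rw [if_pos hsmall, BlockAveragingEMLProp2.coe_avg_eq_eml _ hsmall, eml_eq_exp]
  -- the line transport is `exp(s)`, `s = log S`
  set s : Matrix n n ℂ := mlog S with hs
  have hS_exp : S = exp s := (exp_mlog (by linarith only [hS1, hσ1] : ‖S - 1‖ < 1)).symm
  -- `Ū(c) = exp X̄ · exp s`
  have hU : ((avgFun (expMeanLogSU (n := n)) U c : Matrix.specialUnitaryGroup n ℂ) : Matrix n n ℂ) = exp Xbar * exp s := by
    rw [← hS_exp, ← hcorr, hS, ← Submonoid.coe_mul]; rfl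
  -- sizes of `X̄` and `s`
  have hlogW : ∀ i, ‖mlog (W i)‖ ≤ 4 * σ := fun i =>
    (norm_mlog_le_two_mul ((hW1 i).trans (by linarith only [hσ1]))).trans (by linarith only [hW1 i])
  have hXbar4 : ‖Xbar‖ ≤ 4 * σ := norm_mean_le' hlogW
  have hs4 : ‖s‖ ≤ 4 * σ := (norm_mlog_le_two_mul (hS1.trans (by linarith only [hσ1]))).trans (by linarith only [hS1])
  -- decompositions of `X̄` and `s`
  set Rbar : Matrix n n ℂ := ((Fintype.card (Idx P) : ℂ))⁻¹ • ∑ i, R i with hRbar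
  have hXdec : Xbar = wbar + (2 : ℂ)⁻¹ • pbar + Rbar := by
    have hsum : ∑ i, mlog (W i) = ∑ i, walkSum Y (γ i) + (2 : ℂ)⁻¹ • ∑ i, pairBr (sg (γ i)) + ∑ i, R i := by
      rw [Finset.smul_sum, ← Finset.sum_add_distrib, ← Finset.sum_add_distrib]
      refine Finset.sum_congr rfl fun i _ => ?_
      simp only [hR]; abel
    rw [hXbar, hsum, smul_add, smul_add, smul_comm ((Fintype.card (Idx P) : ℂ))⁻¹ ((2 : ℂ)⁻¹) (∑ i, pairBr (sg (γ i)))]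
  have hsdec : s = walkSum Y Λ + (2 : ℂ)⁻¹ • pΛ + RS := by simp only [hRS, hs]; abel
  have hwbarσ : ‖wbar‖ ≤ σ := norm_mean_le' hwγ
  have hpbarσ : ‖pbar‖ ≤ σ ^ 2 := norm_mean_le' hpγ
  have hRbarσ : ‖Rbar‖ ≤ 3400 * σ ^ 3 := norm_mean_le' hRi
  -- the two-factor BCH for `exp X̄ · exp s`
  have hsum20 : ‖Xbar‖ + ‖s‖ ≤ 3 / 20 := by linarith only [hXbar4, hs4, hσ1]
  have hbch := norm_logOnePlus_sub_bch3_le_mul Xbar s hsum20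
  have hcub := norm_bch3_sub_second_order_le Xbar s
  -- the exact algebra
  have hlog : mlog ((avgFun (expMeanLogSU (n := n)) U c : Matrix.specialUnitaryGroup n ℂ) : Matrix n n ℂ) = logOnePlus (exp Xbar * exp s - 1) := by
    rw [mlog_def, hU]
  have h2 : Xbar + s + (2 : ℂ)⁻¹ • ⁅Xbar, s⁆ =
      (wbar + walkSum Y Λ) + (2 : ℂ)⁻¹ • (pbar + pΛ + ⁅wbar, walkSum Y Λ⁆) +
        (Rbar + RS + (2 : ℂ)⁻¹ • (⁅Xbar, s⁆ - ⁅wbar, walkSum Y Λ⁆)) := by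
    calc Xbar + s + (2 : ℂ)⁻¹ • ⁅Xbar, s⁆
        = (wbar + (2 : ℂ)⁻¹ • pbar + Rbar) + (walkSum Y Λ + (2 : ℂ)⁻¹ • pΛ + RS) + (2 : ℂ)⁻¹ • ⁅Xbar, s⁆ := by
          rw [← hXdec, ← hsdec]
      _ = (wbar + walkSum Y Λ) + (2 : ℂ)⁻¹ • (pbar + pΛ + ⁅wbar, walkSum Y Λ⁆) +
            (Rbar + RS + (2 : ℂ)⁻¹ • (⁅Xbar, s⁆ - ⁅wbar, walkSum Y Λ⁆)) := by
          simp only [smul_add, smul_sub]; abel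
  have e : mlog ((avgFun (expMeanLogSU (n := n)) U c : Matrix.specialUnitaryGroup n ℂ) : Matrix n n ℂ) -
      ((wbar + walkSum Y Λ) + (2 : ℂ)⁻¹ • (pbar + pΛ + ⁅wbar, walkSum Y Λ⁆)) =
      (logOnePlus (exp Xbar * exp s - 1) - bch3 Xbar s) + (bch3 Xbar s - (Xbar + s + (2 : ℂ)⁻¹ • ⁅Xbar, s⁆)) +
        (Rbar + RS + (2 : ℂ)⁻¹ • (⁅Xbar, s⁆ - ⁅wbar, walkSum Y Λ⁆)) := by
    rw [hlog]
    -- replace the statement's bracket by `X̄ + s + ½[X̄,s] − (cubic part)` using `h2`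
    have h2' : (wbar + walkSum Y Λ) + (2 : ℂ)⁻¹ • (pbar + pΛ + ⁅wbar, walkSum Y Λ⁆) =
        Xbar + s + (2 : ℂ)⁻¹ • ⁅Xbar, s⁆ - (Rbar + RS + (2 : ℂ)⁻¹ • (⁅Xbar, s⁆ - ⁅wbar, walkSum Y Λ⁆)) := by
      rw [h2]; abel
    rw [h2']; abel
  -- the commutator cross terms are cubic
  have h2norm : ‖(2 : ℂ)‖ = 2 := by simp
  have hlie : ∀ A B : Matrix n n ℂ, ‖⁅A, B⁆‖ ≤ 2 * ‖A‖ * ‖B‖ := fun A B => by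
    rw [Ring.lie_def]
    calc ‖A * B - B * A‖ ≤ ‖A * B‖ + ‖B * A‖ := norm_sub_le _ _
      _ ≤ ‖A‖ * ‖B‖ + ‖B‖ * ‖A‖ := add_le_add (norm_mul_le _ _) (norm_mul_le _ _)
      _ = 2 * ‖A‖ * ‖B‖ := by ring
  have hcomm : ‖⁅Xbar, s⁆ - ⁅wbar, walkSum Y Λ⁆‖ ≤ 350 * σ ^ 3 := by
    have e2 : ⁅Xbar, s⁆ - ⁅wbar, walkSum Y Λ⁆ = ⁅Xbar - wbar, s⁆ + ⁅wbar, s - walkSum Y Λ⁆ := by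
      simp only [Ring.lie_def]; noncomm_ring
    rw [e2]
    have hσ32 : σ ^ 3 ≤ σ ^ 2 * (1 / 100) := by
      have : σ ^ 3 = σ ^ 2 * σ := by ring
      rw [this]; exact mul_le_mul_of_nonneg_left hσ1 (pow_nonneg hσ0 2)
    have hd1 : ‖Xbar - wbar‖ ≤ 35 * σ ^ 2 := by
      have : Xbar - wbar = (2 : ℂ)⁻¹ • pbar + Rbar := by rw [hXdec]; abel
      rw [this]
      refine (norm_add_le _ _).trans ?_
      rw [norm_smul, norm_inv, h2norm]
      linarith only [hpbarσ, hRbarσ, hσ32, pow_nonneg hσ0 2]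
    have hd2 : ‖s - walkSum Y Λ‖ ≤ 35 * σ ^ 2 := by
      have : s - walkSum Y Λ = (2 : ℂ)⁻¹ • pΛ + RS := by rw [hsdec]; abel
      rw [this]
      refine (norm_add_le _ _).trans ?_
      rw [norm_smul, norm_inv, h2norm]
      linarith only [hpΛ', hRS', hσ32, pow_nonneg hσ0 2]
    have hprod1 : ‖Xbar - wbar‖ * ‖s‖ ≤ (35 * σ ^ 2) * (4 * σ) :=
      mul_le_mul hd1 hs4 (norm_nonneg _) (mul_nonneg (by norm_num) (pow_nonneg hσ0 2))
    have hprod2 : ‖wbar‖ * ‖s - walkSum Y Λ‖ ≤ σ * (35 * σ ^ 2) :=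
      mul_le_mul hwbarσ hd2 (norm_nonneg _) hσ0
    calc ‖⁅Xbar - wbar, s⁆ + ⁅wbar, s - walkSum Y Λ⁆‖ ≤ 2 * ‖Xbar - wbar‖ * ‖s‖ + 2 * ‖wbar‖ * ‖s - walkSum Y Λ‖ :=
          (norm_add_le _ _).trans (add_le_add (hlie _ _) (hlie _ _))
      _ ≤ 2 * ((35 * σ ^ 2) * (4 * σ)) + 2 * (σ * (35 * σ ^ 2)) := by linarith only [hprod1, hprod2]
      _ = 350 * σ ^ 3 := by ring
  -- assemble
  have h8 : ‖Xbar‖ + ‖s‖ ≤ 8 * σ := by linarith only [hXbar4, hs4]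
  have hXs0 : 0 ≤ ‖Xbar‖ + ‖s‖ := by positivity
  have hpow3 : (‖Xbar‖ + ‖s‖) ^ 3 ≤ (8 * σ) ^ 3 := pow_le_pow_left₀ hXs0 h8 3
  have hA : ‖logOnePlus (exp Xbar * exp s - 1) - bch3 Xbar s‖ ≤ 12000 * (4 * σ) * (8 * σ) ^ 3 := by
    refine hbch.trans ?_
    exact mul_le_mul (mul_le_mul_of_nonneg_left hXbar4 (by norm_num)) hpow3 (pow_nonneg hXs0 3)
      (mul_nonneg (by norm_num) (mul_nonneg (by norm_num) hσ0))
  have hB : ‖bch3 Xbar s - (Xbar + s + (2 : ℂ)⁻¹ • ⁅Xbar, s⁆)‖ ≤ 12⁻¹ * (8 * σ) ^ 3 := by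
    refine hcub.trans ?_
    exact mul_le_mul_of_nonneg_left hpow3 (by norm_num)
  have hC : ‖(2 : ℂ)⁻¹ • (⁅Xbar, s⁆ - ⁅wbar, walkSum Y Λ⁆)‖ ≤ 2⁻¹ * (350 * σ ^ 3) := by
    rw [norm_smul, norm_inv, h2norm]; exact mul_le_mul_of_nonneg_left hcomm (by norm_num)
  have hσ3 : 0 ≤ σ ^ 3 := pow_nonneg hσ0 3
  have hσ4 : σ ^ 4 ≤ σ ^ 3 * (1 / 100) := by
    have : σ ^ 4 = σ ^ 3 * σ := by ring
    rw [this]; exact mul_le_mul_of_nonneg_left hσ1 hσ3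
  rw [e]
  calc ‖(logOnePlus (exp Xbar * exp s - 1) - bch3 Xbar s) + (bch3 Xbar s - (Xbar + s + (2 : ℂ)⁻¹ • ⁅Xbar, s⁆)) +
          (Rbar + RS + (2 : ℂ)⁻¹ • (⁅Xbar, s⁆ - ⁅wbar, walkSum Y Λ⁆))‖
      ≤ (‖logOnePlus (exp Xbar * exp s - 1) - bch3 Xbar s‖ + ‖bch3 Xbar s - (Xbar + s + (2 : ℂ)⁻¹ • ⁅Xbar, s⁆)‖) +
          (‖Rbar‖ + ‖RS‖ + ‖(2 : ℂ)⁻¹ • (⁅Xbar, s⁆ - ⁅wbar, walkSum Y Λ⁆)‖) :=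
        (norm_add_le _ _).trans (add_le_add (norm_add_le _ _) ((norm_add_le _ _).trans (add_le_add (norm_add_le _ _) le_rfl)))
    _ ≤ (12000 * (4 * σ) * (8 * σ) ^ 3 + 12⁻¹ * (8 * σ) ^ 3) + (3400 * σ ^ 3 + 3400 * σ ^ 3 + 2⁻¹ * (350 * σ ^ 3)) :=
        add_le_add (add_le_add hA hB) (add_le_add (add_le_add hRbarσ hRS') hC)
    _ ≤ 300000 * σ ^ 3 := by nlinarith only [hσ4, hσ3]

end Summit.QuantumFields.YangMills.Theorems.EMLSecondOrder

end
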